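import Mathlib
import Literature.NumberTheory.LFunctions.SuzukiCanonicalSystem
import Literature.NumberTheory.LFunctions.SuzukiSingleOperatorKernelProofs
import HarnessLib

/-!
# The Hilbert–Schmidt window test (K-general, RH-free, ζ-free)

Glue between the DBR column's CERTIFIED data rungs (ET1/ET1b of cell rh-dbr: interval-arithmetic
enclosures of `h(t) = ∫∫_{(−t,t)²} K_θ(x+y)² dx dy`) and the window statement of route
`SuzukiWindowsDoor`: if the (iterated) Hilbert–Schmidt integral of the kernel `K(x+y)` over the square
`(−t,t)²` is `< 1`, then `±1` is not an eigenvalue of `f ↦ ∫_{(−t,t)} K(·+y) f(y) dy` on `L²(−t,t)`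
(`NoUnitEigenvalue K t`). This is the Hilbert–Schmidt sibling of the tree's sup-norm test
`Literature.NumberTheory.LFunctions.noUnitEigenvalue_of_small_window` ([Su21] Prop. 4.2 mechanism:
"the operator is small on small windows"), proved by the AM–GM form of Cauchy–Schwarz on
`‖f‖² = ε ∫∫ K(x+y) f(x) f(y)`. RH-FREE; nothing here bears on the truth of RH: a window certified this
way is an unconditional finite fact about one explicit operator.

References: M. Suzuki, J. Funct. Anal. 281 (2021) 109116 = arXiv:1606.05726, Prop. 4.2 (§4.2);
M. Suzuki, Adv. Stud. Pure Math. 84 (2020) 399–411 = arXiv:1907.07302, Thm. 1.2 (K-v).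
-/

set_option linter.dupNamespace false

noncomputable section

open MeasureTheory Set

namespace Summit.RiemannHypothesis.RiemannHypothesis.Theorems.SuzukiWindowsDoorHSWindow

/-- AM–GM with a weight: `2ab ≤ λ a² + b²/λ` for `λ > 0`. [folklore] -/
theorem two_mul_le_weighted_sq (a b lam : ℝ) (hlam : 0 < lam) :
    2 * (a * b) ≤ lam * a ^ 2 + b ^ 2 / lam := by
  have h : 0 ≤ (lam * a - b) ^ 2 / lam := div_nonneg (sq_nonneg _) hlam.le
  have : (lam * a - b) ^ 2 / lam = lam * a ^ 2 - 2 * (a * b) + b ^ 2 / lam := by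
    field_simp
    ring
  linarith [this ▸ h]

/-- **Hilbert–Schmidt window test** (RH-free, `ζ`-free, K-general). Let `S = (−t,t)`. If for a.e.
`x ∈ S` the function `y ↦ K(x+y)²` is integrable on `S`, the iterated integral
`x ↦ ∫_S K(x+y)² dy` is integrable on `S`, and `∫_S ∫_S K(x+y)² dy dx < 1` (the squared
Hilbert–Schmidt norm of the compressed operator `𝖪[t]`), then `±1` are not eigenvalues of
`f ↦ ∫_S K(· + y) f(y) dy` on `L²(S)`: `NoUnitEigenvalue K t`.
Proof: for an eigenfunction, `∫_S f² = ε ∫_S ∫_S K(x+y) f(x) f(y)`; bound the integrand by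
`(λ K(x+y)² + f(x)² f(y)²/λ)/2` with `λ = ∫ f²` to get `(1 − h) ∫ f² ≤ 0`.
[cite: Suzuki2021Hamiltonians, Prop. 4.2 (proof, §4.2)] -/
theorem noUnitEigenvalue_of_hsNormSq_lt_one {K : ℝ → ℝ} {t : ℝ} (hKm : Measurable K)
    (hKy : ∀ᵐ x ∂(volume.restrict (Ioo (-t) t)), IntegrableOn (fun y => K (x + y) ^ 2) (Ioo (-t) t))
    (hKx : IntegrableOn (fun x => ∫ y in Ioo (-t) t, K (x + y) ^ 2) (Ioo (-t) t))
    (hHS : ∫ x in Ioo (-t) t, ∫ y in Ioo (-t) t, K (x + y) ^ 2 < 1) :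
    Literature.NumberTheory.LFunctions.NoUnitEigenvalue K t := by
  intro ε hε f hf heig
  set μ : Measure ℝ := volume.restrict (Ioo (-t) t) with hμ
  have hε2 : ε ^ 2 = 1 := by rcases hε with rfl | rfl <;> norm_num
  have hεabs : |ε| = 1 := by rcases hε with rfl | rfl <;> norm_num
  haveI : IsFiniteMeasure μ := by
    rw [hμ]; exact isFiniteMeasure_restrict.2 (by rw [Real.volume_Ioo]; exact ENNReal.ofReal_ne_top)
  -- basic integrability facts
  have hf2 : Integrable (fun x => f x ^ 2) μ := hf.integrable_sq
  set A : ℝ := ∫ x, f x ^ 2 ∂μ with hA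
  have hA0 : 0 ≤ A := integral_nonneg fun x => sq_nonneg _
  set H : ℝ := ∫ x, ∫ y, K (x + y) ^ 2 ∂μ ∂μ with hH
  have hH1 : H < 1 := hHS
  have hH0 : 0 ≤ H := integral_nonneg fun x => integral_nonneg fun y => sq_nonneg _
  -- K(x+·) ∈ L²(μ) for a.e. x, hence K(x+·) f ∈ L¹(μ) for a.e. x
  have hKL2 : ∀ᵐ x ∂μ, MemLp (fun y => K (x + y)) 2 μ := by
    filter_upwards [hKy] with x hx
    have hm : AEStronglyMeasurable (fun y => K (x + y)) μ :=
      (hKm.comp (measurable_const.add measurable_id)).aestronglyMeasurable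
    exact (memLp_two_iff_integrable_sq hm).2 hx
  have hKf : ∀ᵐ x ∂μ, Integrable (fun y => K (x + y) * f y) μ := by
    filter_upwards [hKL2] with x hx
    exact hx.integrable_mul hf
  -- the pointwise identity  f x ^ 2 = ∫ ε f x K(x+y) f y dy  (a.e. x)
  have hpt : ∀ᵐ x ∂μ, f x ^ 2 = ∫ y, ε * f x * (K (x + y) * f y) ∂μ := by
    filter_upwards [heig] with x hx
    rw [integral_const_mul, hx]
    calc f x ^ 2 = ε ^ 2 * f x ^ 2 := by rw [hε2, one_mul]
      _ = ε * f x * (ε * f x) := by ring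
  -- pointwise AM-GM bound inside, with weight lam > 0
  have key : ∀ lam : ℝ, 0 < lam → A ≤ lam / 2 * H + A * A / (2 * lam) := by
    intro lam hlam
    -- inner bound for a.e. x:  ∫ ε f x K f ≤ ∫ (lam K² + (f x)² (f y)²/lam)/2
    have hinner : ∀ᵐ x ∂μ, f x ^ 2 ≤ lam / 2 * ∫ y, K (x + y) ^ 2 ∂μ + f x ^ 2 * A / (2 * lam) := by
      filter_upwards [hpt, hKf, hKy] with x hx hKfx hKyx
      have h1 : Integrable (fun y => K (x + y) ^ 2) μ := hKyx
      have hrhs_int : Integrable (fun y => (lam * K (x + y) ^ 2 + (f x * f y) ^ 2 / lam) / 2) μ := by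
        have : Integrable (fun y => lam * K (x + y) ^ 2 + (f x) ^ 2 / lam * f y ^ 2) μ :=
          (h1.const_mul lam).add (hf2.const_mul _)
        refine (this.div_const 2).congr (Filter.Eventually.of_forall fun y => ?_)
        simp only
        ring
      have hmono : ∫ y, ε * f x * (K (x + y) * f y) ∂μ ≤
          ∫ y, (lam * K (x + y) ^ 2 + (f x * f y) ^ 2 / lam) / 2 ∂μ := by
        refine integral_mono_ae (hKfx.const_mul _) hrhs_int (Filter.Eventually.of_forall fun y => ?_)
        have hb := two_mul_le_weighted_sq (K (x + y)) (f x * f y) lam hlam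
        have hb' := two_mul_le_weighted_sq (-K (x + y)) (f x * f y) lam hlam
        have habs : ε * f x * (K (x + y) * f y) ≤ |K (x + y) * (f x * f y)| := by
          calc ε * f x * (K (x + y) * f y) = ε * (K (x + y) * (f x * f y)) := by ring
            _ ≤ |ε * (K (x + y) * (f x * f y))| := le_abs_self _
            _ = |K (x + y) * (f x * f y)| := by rw [abs_mul, hεabs, one_mul]
        have habs2 : |K (x + y) * (f x * f y)| ≤ (lam * K (x + y) ^ 2 + (f x * f y) ^ 2 / lam) / 2 := by
          rw [abs_le]
          constructor
          · nlinarith [hb', sq_nonneg (K (x + y))]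
          · nlinarith [hb]
        exact habs.trans habs2
      have heq : ∫ y, (lam * K (x + y) ^ 2 + (f x * f y) ^ 2 / lam) / 2 ∂μ =
          lam / 2 * ∫ y, K (x + y) ^ 2 ∂μ + f x ^ 2 * A / (2 * lam) := by
        calc ∫ y, (lam * K (x + y) ^ 2 + (f x * f y) ^ 2 / lam) / 2 ∂μ
            = ∫ y, (lam / 2 * K (x + y) ^ 2 + f x ^ 2 / (2 * lam) * f y ^ 2) ∂μ := by
              refine integral_congr_ae (Filter.Eventually.of_forall fun y => ?_); simp only; ring
          _ = lam / 2 * ∫ y, K (x + y) ^ 2 ∂μ + f x ^ 2 / (2 * lam) * ∫ y, f y ^ 2 ∂μ := by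
              rw [integral_add (h1.const_mul _) (hf2.const_mul _), integral_const_mul, integral_const_mul]
          _ = lam / 2 * ∫ y, K (x + y) ^ 2 ∂μ + f x ^ 2 * A / (2 * lam) := by rw [← hA]; ring
      calc f x ^ 2 = ∫ y, ε * f x * (K (x + y) * f y) ∂μ := hx
        _ ≤ _ := hmono
        _ = _ := heq
    -- integrate over x
    have hrhs : Integrable (fun x => lam / 2 * ∫ y, K (x + y) ^ 2 ∂μ + f x ^ 2 * A / (2 * lam)) μ := by
      have : Integrable (fun x => lam / 2 * ∫ y, K (x + y) ^ 2 ∂μ + A / (2 * lam) * f x ^ 2) μ :=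
        (hKx.const_mul _).add (hf2.const_mul _)
      refine this.congr (Filter.Eventually.of_forall fun x => ?_); simp only; ring
    have := integral_mono_ae hf2 hrhs hinner
    rw [← hA] at this
    refine this.trans (le_of_eq ?_)
    calc ∫ x, (lam / 2 * ∫ y, K (x + y) ^ 2 ∂μ + f x ^ 2 * A / (2 * lam)) ∂μ
        = ∫ x, (lam / 2 * ∫ y, K (x + y) ^ 2 ∂μ + A / (2 * lam) * f x ^ 2) ∂μ := by
          refine integral_congr_ae (Filter.Eventually.of_forall fun x => ?_); simp only; ring
      _ = lam / 2 * H + A / (2 * lam) * A := by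
          rw [integral_add (hKx.const_mul _) (hf2.const_mul _), integral_const_mul, integral_const_mul,
            ← hH, ← hA]
      _ = lam / 2 * H + A * A / (2 * lam) := by ring
  -- conclude A = 0
  have hAz : A = 0 := by
    by_contra hne
    have hApos : 0 < A := lt_of_le_of_ne hA0 (Ne.symm hne)
    have hk := key A hApos
    -- A ≤ A H /2 + A/2  ⇒  A (1 - H) ≤ 0
    have h1 : A * A / (2 * A) = A / 2 := by field_simp
    rw [h1] at hk
    nlinarith [hk, hH1, hApos]
  -- f = 0 a.e.
  have hsq : (fun x => f x ^ 2) =ᵐ[μ] 0 := by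
    have := (integral_eq_zero_iff_of_nonneg_ae (Filter.Eventually.of_forall fun x => sq_nonneg (f x)) hf2).1
    rw [← hA] at this
    exact this hAz
  filter_upwards [hsq] with x hx
  simpa using hx

/-- **Instance shape for Suzuki's single operator** (RH-free): for `θ > 1`, if the iterated
Hilbert–Schmidt integral of `K_θ = limKernel θ` over `(−t,t)²` is `< 1`, then `𝖪_θ[t]` has no eigenvalue
`±1` (`NoUnitEigenvalue (limKernel θ) t`). The integrability side conditions of
`noUnitEigenvalue_of_hsNormSq_lt_one` are discharged by the continuity of `K_θ`
([Su20] Thm. 1.2 (K-ii), tree theorem `Suzuki2020_thm12_continuous`). The numerical premise is what the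
DBR engine certifies by interval arithmetic (cell rh-dbr, DATA.md §ET1: e.g. it holds for θ = 12 and every
t ≤ 0.8268589049397, and for θ = 20 and every t ≤ 1.2384061469859); such an instance is an unconditional
finite fact, never evidence for RH. [cite: Suzuki2020IntegralOperators, Thm. 1.2 (K-v)] -/
theorem noUnitEigenvalue_limKernel_of_hsNormSq_lt_one {θ t : ℝ} (hθ : 1 < θ)
    (hHS : ∫ x in Ioo (-t) t, ∫ y in Ioo (-t) t,
      (Literature.NumberTheory.LFunctions.limKernel θ (x + y)) ^ 2 < 1) :
    Literature.NumberTheory.LFunctions.NoUnitEigenvalue (Literature.NumberTheory.LFunctions.limKernel θ) t := by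
  set K := Literature.NumberTheory.LFunctions.limKernel θ with hK
  have hKc : Continuous K := Literature.NumberTheory.LFunctions.Suzuki2020_thm12_continuous hθ
  have hKm : Measurable K := hKc.measurable
  -- a bound for K² on the relevant range [-2|t|, 2|t|]
  obtain ⟨C, hC⟩ := (isCompact_Icc : IsCompact (Icc (-(2 * |t|)) (2 * |t|))).exists_bound_of_continuousOn
    ((hKc.pow 2).continuousOn)
  have hbound : ∀ x ∈ Ioo (-t) t, ∀ y ∈ Ioo (-t) t, ‖K (x + y) ^ 2‖ ≤ C := by
    intro x hx y hy
    refine hC (x + y) ⟨?_, ?_⟩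
    · nlinarith [hx.1, hy.1, le_abs_self t, neg_abs_le t, abs_nonneg t]
    · nlinarith [hx.2, hy.2, le_abs_self t]
  haveI hfin : IsFiniteMeasure (volume.restrict (Ioo (-t) t)) :=
    isFiniteMeasure_restrict.2 (by rw [Real.volume_Ioo]; exact ENNReal.ofReal_ne_top)
  -- (i) for every x: y ↦ K(x+y)² is integrable on the window (continuous on a bounded interval)
  have hKy : ∀ᵐ x ∂(volume.restrict (Ioo (-t) t)), IntegrableOn (fun y => K (x + y) ^ 2) (Ioo (-t) t) := by
    refine Filter.Eventually.of_forall fun x => ?_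
    have hc : Continuous fun y => K (x + y) ^ 2 := (hKc.comp (continuous_const.add continuous_id)).pow 2
    exact (hc.integrableOn_Icc (a := -t) (b := t)).mono_set Ioo_subset_Icc_self
  -- (ii) x ↦ ∫ K(x+y)² dy is measurable and bounded, hence integrable on the window
  have hKx : IntegrableOn (fun x => ∫ y in Ioo (-t) t, K (x + y) ^ 2) (Ioo (-t) t) := by
    have hsm : StronglyMeasurable (Function.uncurry fun x y : ℝ => K (x + y) ^ 2) :=
      ((hKm.comp (measurable_fst.add measurable_snd)).pow_const 2).stronglyMeasurable
    have hmeas : StronglyMeasurable fun x : ℝ => ∫ y in Ioo (-t) t, K (x + y) ^ 2 :=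
      hsm.integral_prod_right
    refine Integrable.mono' (integrable_const (C * volume.real (Ioo (-t) t)))
      hmeas.aestronglyMeasurable ?_
    filter_upwards [ae_restrict_mem measurableSet_Ioo] with x hx
    exact norm_setIntegral_le_of_norm_le_const (μ := volume) (s := Ioo (-t) t)
      (by rw [Real.volume_Ioo]; exact ENNReal.ofReal_lt_top) (fun y hy => hbound x hx y hy)
  exact noUnitEigenvalue_of_hsNormSq_lt_one hKm hKy hKx hHS

end Summit.RiemannHypothesis.RiemannHypothesis.Theorems.SuzukiWindowsDoorHSWindow

end
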